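import Mathlib
import Literature.Computability.Complexity.CircuitClasses
import Literature.Computability.Complexity.Classes
import Literature.Computability.Complexity.Promise
import Literature.Computability.MetaComplexity.FormulaModelsAE
import Literature.Computability.MetaComplexity.LevinKt
import Literature.Computability.MetaComplexity.XorBottomModelsAE
import Literature.Computability.MetaComplexity.OliveiraPichSanthanam2019.GapMKtPMagnification
import HarnessLib

/-!
# Oliveira–Pich–Santhanam, Theorem 1.1 item 2: hardness magnification for `Gap-MKtP` against
# `U₂-Formula-⊕[N^{1+ε}]` (formulas with parity leaves) — as a named fact (census row R20)

Source: I. C. Oliveira, J. Pich, R. Santhanam, *Hardness magnification near state-of-the-art lower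
bounds*, Theory of Computing 17(11), 2021 (CCC 2019) (bib key `OliveiraPichSanthanam2021`), Theorem
1.1 (p. 5) and Notation (p. 4). Companion of `GapMKtPMagnification.lean` (items 1, 5, 6 and the
thresholds `powThreshold`, `powLogThreshold`, `powSize`), over the parity-leaf formula class
`FORMULAXORae` of `XorBottomModelsAE.lean`.

## The printed statements (verbatim)

* Notation (p. 4): *"We consider formulas over the bases U₂ (fan-in two ANDs and ORs), B₂ (all
  boolean functions over two input bits), and extended U₂-formulas where the input leaves are
  labelled by literals, constants, or parity functions over the input bits of arbitrary arity. The
  corresponding classes of formulas of size at most s (measured by the number of leaves) will be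
  denoted by U₂-Formula[s], B₂-Formula[s], and U₂-Formula-⊕[s], respectively."*
* Theorem 1.1 (p. 5): *"There is a universal constant c ≥ 1 for which the following hold. If there
  exists ε > 0 such that for every small enough β > 0 … 2. Gap-MKtP[2^{βn}, 2^{βn} + cn] ∉
  U₂-Formula-⊕[N^{1+ε}], then EXP ⊄ Formula[poly]. … 6. Gap-MKtP[2^{βn}, 2^{βn} + cn] ∉
  U₂-Formula[N^{3+ε}], then EXP ⊄ Formula[poly]. … 8. Gap-MKtP[2^{βn}, 2^{βn} + cn] ∉
  (AC⁰[6])[N^{1+ε}], then EXP ⊄ AC⁰[6]."* (`n = log N`.)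

## Census value (row R20)

T = item 2: parity-leaf De Morgan formulas with `N^{1+ε}` leaves. In THIS model no lower bound for
`Gap-MKtP` is in print (the explicit-function record is `InnerProduct ∉ Formula-XOR[N^{1.99}]`, Tal
2017 = CHOPRS item B3 — context only, census rule F10); the known `MKtP` formula bounds are in the
plain `U₂`-formula model (`N^{2−o(1)}`-type, OPS Theorems 1.2/1.3, row R16), a SMALLER class:
MODEL-MISMATCH, no numeric gap. Same-model reading: a parity of `m ≤ N` input bits has a De Morgan
formula with `O(m²)` leaves, so `U₂-Formula-⊕[N^{1+ε}] ⊆ U₂-Formula[O(N^{3+ε})]` and item 6 (row R16,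
`thm11_item6`) is the De Morgan-model form of item 2. Item 8 (`AC⁰[6]`, i.e. constant depth with
`MOD 6` gates, almost-linear size) is recorded here as text only: the tree has `ACC0`/`AC0Mod` but no
almost-everywhere size-bounded `AC⁰[m]` class yet.

## Rendering (T side: our hypothesis implies the printed one)

* `Gap-MKtP[2^{βn}, 2^{βn} + cn]` ↦ `U.gapMKtP (powThreshold β) (powLogThreshold β c)` exactly as in
  `GapMKtPMagnification.lean` (integer `Kt`, exact floors; `∀ U : UniversalMachine`, `c` depending on
  `U`).
* `U₂-Formula-⊕[N^{1+ε}]` ↦ `FORMULAXORae (powSize (1 + ε))`: De Morgan formulas whose leaves are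
  literals or parity gates reading inputs only, leaf count (a parity leaf counts one) eventually
  `≤ ⌊N^{1+ε}⌋` (`XorBottomModelsAE`; constants among the printed leaves are propagated away, a
  constant formula becoming `⊕₀`/`¬⊕₀` with one leaf, so the printed class is contained in ours as soon
  as the bound is `≥ 1`, which `⌊N^{1+ε}⌋` is for `N ≥ 1`). A lower bound against our (larger, a.e.)
  class implies the printed (every-length) one.
* `EXP ⊄ Formula[poly]` ↦ `EXPNotInFormulaPoly` of `GapMKtPMagnification.lean` (as for items 5, 6).
* NON-VACUITY (F1): `headLang ∈ FORMULAXORae (powSize κ)` for `κ ≥ 0` and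
  `PromiseProblem.ofLanguage headLang ∈ promiseLift (FORMULAXORae (powSize (1 + ε)))` for `ε ≥ -1` are
  the tree lemmas `Literature.Computability.MetaComplexity.headLang_mem_FORMULAXORae_powSize` /
  `ofLanguage_headLang_mem_promiseLift_FORMULAXORae` (`MagnificationFrontierBC.lean`, not imported
  here); so the hypothesis class of item 2 is not empty.
* HONEST FRAMING: a THRESHOLD fact; `MKtPFormulaXorHypothesis` is OPEN; nothing here is an approach
  to the summit.
-/

noncomputable section

namespace Literature.Computability.MetaComplexity.OliveiraPichSanthanam2019

open Filter Topology
open Literature.Computability.Complexity Literature.Computability.MetaComplexity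
open UniversalMachine

/-- **`Gap-MKtP[2^{βn}, 2^{βn} + cn] ∉ U₂-Formula-⊕[N^{κ}]`** for the machine `U` (item 2 uses
`κ = 1 + ε`): no language decided by parity-leaf De Morgan formula families of eventually at most
`⌊N^κ⌋` leaves separates YES from NO. [cite: OliveiraPichSanthanam2021, Thm. 1.1 item 2 (hypothesis)] -/
def GapMKtPFormulaXorLB (U : UniversalMachine) (c : ℕ) (κ β : ℝ) : Prop :=
  U.gapMKtP (powThreshold β) (powLogThreshold β c) ∉ promiseLift (FORMULAXORae (powSize κ))

/-- **Hypothesis of Theorem 1.1 item 2 for the constant `c`** (OPEN — census row R20,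
`U₂-Formula-⊕`): *"there exists ε > 0 such that for every small enough β > 0,
Gap-MKtP[2^{βn}, 2^{βn} + cn] ∉ U₂-Formula-⊕[N^{1+ε}]"*.
[cite: OliveiraPichSanthanam2021, Thm. 1.1 item 2 (hypothesis)] -/
def MKtPFormulaXorHypothesis (U : UniversalMachine) (c : ℕ) : Prop :=
  ∃ ε : ℝ, 0 < ε ∧ ∃ β₀ : ℝ, 0 < β₀ ∧ ∀ β : ℝ, 0 < β → β < β₀ → GapMKtPFormulaXorLB U c (1 + ε) β

/-- **Oliveira–Pich–Santhanam, Theorem 1.1 item 2** (hardness magnification for `MKtP`,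
parity-leaf formulas) as a named fact: *"There is a universal constant c ≥ 1 for which the following
hold. If there exists ε > 0 such that for every small enough β > 0 … (2) Gap-MKtP[2^{βn}, 2^{βn} + cn]
∉ U₂-Formula-⊕[N^{1+ε}], then EXP ⊄ Formula[poly]."* Users take `(h : thm11_item2)`.
[cite: OliveiraPichSanthanam2021, Thm. 1.1 item 2] -/
def thm11_item2 : Prop :=
  ∀ U : UniversalMachine, ∃ c : ℕ, 1 ≤ c ∧ (MKtPFormulaXorHypothesis U c → EXPNotInFormulaPoly)

/-! ### API -/

/-- Consequence shape of item 2. [cite: OliveiraPichSanthanam2021, Thm. 1.1 item 2] -/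
theorem expNotInFormulaPoly_of_formulaXorHypothesis (h : thm11_item2) (U : UniversalMachine)
    (hU : ∀ c : ℕ, 1 ≤ c → MKtPFormulaXorHypothesis U c) : EXPNotInFormulaPoly := by
  obtain ⟨c, hc, himp⟩ := h U
  exact himp (hU c hc)

/-- A lower bound against parity-leaf formulas of `⌊N^κ⌋` leaves implies the lower bound against
plain De Morgan formulas of `⌊N^κ⌋` leaves (`FORMULAae s ⊆ FORMULAXORae s`). [folklore] -/
theorem GapMKtPFormulaXorLB.toFormulaLB {U : UniversalMachine} {c : ℕ} {κ β : ℝ}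
    (h : GapMKtPFormulaXorLB U c κ β) : GapMKtPFormulaLB U c κ β := fun hmem =>
  h (promiseLift_mono (FORMULAae_subset_FORMULAXORae _) hmem)

/-- The parity-leaf formula lower bound is antitone in the gap constant `c` (a larger `c'` shrinks the
NO side). [folklore] -/
theorem GapMKtPFormulaXorLB.anti_const {U : UniversalMachine} {c c' : ℕ} {κ β : ℝ} (hc : c ≤ c')
    (h : GapMKtPFormulaXorLB U c' κ β) : GapMKtPFormulaXorLB U c κ β := fun hmem =>
  h (gapMKtP_mem_promiseLift_anti (fun _ => le_rfl) (powLogThreshold_mono_const β hc) hmem)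

/-- … and antitone in the size exponent `κ` (a bound against `⌊N^{κ'}⌋` leaves gives one against
`⌊N^κ⌋` leaves for `κ ≤ κ'`). [folklore] -/
theorem GapMKtPFormulaXorLB.anti_exp {U : UniversalMachine} {c : ℕ} {κ κ' β : ℝ} (hκ : κ ≤ κ')
    (h : GapMKtPFormulaXorLB U c κ' β) : GapMKtPFormulaXorLB U c κ β := fun hmem =>
  h (promiseLift_mono (FORMULAXORae_mono ⟨1, fun N hN =>
    Nat.floor_le_floor (Real.rpow_le_rpow_of_exponent_le (by exact_mod_cast hN) hκ)⟩) hmem)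

/-- The hypothesis of item 2 is antitone in `c`; so `thm11_item2` yields the implication for every
`c' ≥ c`. [folklore] -/
theorem MKtPFormulaXorHypothesis.anti_const {U : UniversalMachine} {c c' : ℕ} (hc : c ≤ c')
    (h : MKtPFormulaXorHypothesis U c') : MKtPFormulaXorHypothesis U c := by
  obtain ⟨ε, hε, β₀, hβ₀, hβ⟩ := h
  exact ⟨ε, hε, β₀, hβ₀, fun β h0 h1 => (hβ β h0 h1).anti_const hc⟩

/-- `thm11_item2` in "eventually in `c`" form. [folklore] -/
theorem thm11_item2_iff_eventually :
    thm11_item2 ↔ ∀ U : UniversalMachine, ∃ c : ℕ, 1 ≤ c ∧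
      ∀ c' : ℕ, c ≤ c' → (MKtPFormulaXorHypothesis U c' → EXPNotInFormulaPoly) := by
  constructor
  · intro h U
    obtain ⟨c, hc, himp⟩ := h U
    exact ⟨c, hc, fun c' hcc' h' => himp (h'.anti_const hcc')⟩
  · intro h U
    obtain ⟨c, hc, himp⟩ := h U
    exact ⟨c, hc, himp c le_rfl⟩

end Literature.Computability.MetaComplexity.OliveiraPichSanthanam2019
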